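import Literature.NumberTheory.EllipticCurves.LiuZhangZhang2018.PAdicWaldspurgerEllipticCurveAdditive
import Literature.NumberTheory.EllipticCurves.IntSeriesIdentityPrinciple
import Literature.NumberTheory.EllipticCurves.BurungaleKobayashiNakamuraOta2026.RubinPadicLFunctionValuesProofs
import HarnessLib

/-!
# STUB-IDEAS k2·g6 — `stub_heegnerIndexLowerAtTwo` (crux `SplitBadTwoLowerHalfOfFacts`, item
# stmt-BirchSwinnertonDyer-27851): the LIU–ZHANG–ZHANG ENGINE for T3's analytic node at `p = 2`, typed.

TECHNIQUE (director): literature transfer (recent-theorem / open-question harvest; typed dictionary).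

THE TRANSFER.  Liu–S. Zhang–W. Zhang, *A p-adic Waldspurger formula*, Duke Math. J. 167 (2018)
(= arXiv:1511.08172) fix «a prime p» and assume ONLY that `𝔭` splits in the CM field — «neither the usual
Heegner condition, nor any control of ramification on either representations, characters, or test vectors»
(arXiv p. 3 ll. 40–47; no `p odd` anywhere in the paper).  The tree already consumes this paper twice: at
`3 ∥ N` (crux `ValueContinuityAtThree`, `valueContinuityAtThree_of_thm151_thm153`) and at ADDITIVE primes
(`LiuZhangZhang2018.thm151_thm153_modularCurve_heegnerVector_additive`, route CumulativeHeegnerLeopoldt).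
Here it is pointed at `(F, E, 𝔭, A, χ) = (ℚ, K₀ = ℚ(√−7), 2, A_{f₀}, χ')` — the good pair of k3-g3 — where
  * arXiv Thm 2.20 (global Mellin transform: `M(f)(⟨w+k⟩) = Θ_ord^k f`, all `k`, AND `Θ_ord M(f)(⟨w−1⟩) = f`)
    + Def 4.10 / Lemma 4.11 (universal torus period `𝒫_un(f_±) ∈ 𝒟(ω,K)`, whose weight-`k` values ARE the
    `𝔭`-depleted CM sums of `Θ^{k−1}`) + Prop 4.14 (weight-0 value `= log_{A^±} P^±_χ(f_±)`, Coleman App. A)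
    = k1-g6's research inputs H_B ∧ H_C^{Coleman} IN PRINT at any `p`;
  * arXiv Thm 3.10 = Duke Thm 3.3.2 (the `p`-adic Waldspurger formula, canonical `𝓛(A)`, volume-ONE
    measures, the SAME local period `α_χ(f₊,f₋)` as the complex formula) = (W-a)′ EXACT (no `mod E_ν^×`
    as in Bertolini–Darmon–Prasanna PJM 260 (2012) Thm 2, whose Thm 2.13 moreover needs `(c, pN) = 1`);
  * arXiv Cor 4.13 / Prop 4.12 = Duke Prop 4.3.4 (explicit interpolation with `P_ι(χ) = C_ι(ζ⁺ζ⁻)^k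
    χ(t₊⁻¹t₋)` and the `𝔭`-factor `ε(1/2,ψ,ρ_{A,𝔭}⊗χ̌_{𝔓^c})/L(1/2,ρ_{A,𝔭}⊗χ̌_{𝔓^c})²`) ⊗ de Shalit
    II.4.14 (36)–(37) ⊗ `IntSeries.eq_of_infinite_hasValueAt_eq` = (W-b)′, the factorisation at 2, whose
    constant is CLASS-UNIFORM (one number per good-pair menu entry) + an explicit `𝔭`-digit in `n(key)`.
Quotienting (W-a)′ by YUAN–ZHANG–ZHANG's complex Gross–Zagier formula for the SAME `(A, χ', f₊, f₋)` kills
every test-vector / local-toric / class-number-of-order constant (`α`, `δ_c`, `#Pic(𝒪_c)`) and the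
complementary central value `a = ord₂ L^{alg}(ψ_W^cχ²,1)`: the kernel-checked chain below shows that
`vG0 = (w + γ + υ) + (ν(n) − ρ(n)) + s + t − 2τ + 2i + 2ℓ` carries NO per-odd-prime digit of `d`.

§1  analytic glue (PROVED): the weight points `χ'·⟨2ⁿ⟩` converge to `χ'` on its disc
(`tendsto_pow_two_pow_sub_one`), IntSeries values are continuous at the disc centre
(`tendsto_value_of_hasValueAt`), pointwise identities pass to the limit (`limit_law_of_pointwise`,
`norm_limit_le_of_pointwise`).  §2  the valuation currency (E1–E5) and the PROVED chains
(`vG0_eq_of_chain`, `vG0_lower_of_chain`) with the cancellation of `a` and `aα` visible in the statement.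
§3  the B8/B15 table shape: per key `e = C + dig n`, the class constant pinned by ONE anchor and — better —
ELIMINATED between the two in-tree anchors (`anchor_difference`), a falsifier needing no period constant.
No `sorry`; no instance; no notation.  BSD is NOT proved by any of this; S2′ / T3 is not proved here
either: the file proves the LOGIC of the engine; the research inputs are NAMED in the card
(`Ideas/stub_heegnerIndexLowerAtTwo-k2.md`, slug `stub_heegnerIndexLowerAtTwo-k2`).
-/

noncomputable section

open Filter Topology

namespace Summit.BirchSwinnertonDyer.BirchSwinnertonDyer.Cruxes.SplitBadTwoLowerHalfOfFacts.HeegnerIndexTwo.K2G6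

open Literature.NumberTheory.EllipticCurves

/-! ### §0. The printed engine, by name (the tree's typing TEMPLATE for the fact this line needs) -/

/-- The two Liu–Zhang–Zhang named facts already in the tree (Duke Thm 1.5.1 ∧ 1.5.3 on `X₀(N)`, Heegner
vector, `χ = 𝟙`; multiplicative resp. ADDITIVE `p`, any `p`).  The fact this line needs is the same pair
of theorems in their general form (Duke Thm 3.2.10 ∧ Thm 3.3.2 ∧ Prop 4.3.4) read at
`(ℚ, K₀, 2, A_{f₀}, χ')`; its typing follows these two files (R46's nebentypus CM-value carrier IS LZZ's
finite sum (1.5)).  Recorded here only so that the template is kernel-visible from this sketch. -/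
def PrintedLZZTemplates : Prop :=
  LiuZhangZhang2018.thm151_thm153_modularCurve_heegnerVector ∧
    LiuZhangZhang2018.thm151_thm153_modularCurve_heegnerVector_additive

/-! ### §1. Analytic glue (PROVED) -/

/-- `‖2‖ < 1` in `ℂ₂`. -/
theorem norm_two_lt_one : ‖((2 : ℕ) : ℂ_[2])‖ < 1 := by
  rw [← map_natCast (algebraMap ℚ_[2] ℂ_[2]) 2, norm_algebraMap']
  exact Padic.norm_p_lt_one

/-- One squaring step on the unit disc around `1`: `‖u² − 1‖ ≤ ‖u − 1‖ · max(‖u − 1‖, ‖2‖)`. -/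
theorem norm_sq_sub_one_le (u : ℂ_[2]) :
    ‖u ^ 2 - 1‖ ≤ ‖u - 1‖ * max ‖u - 1‖ ‖((2 : ℕ) : ℂ_[2])‖ := by
  have hfac : u ^ 2 - 1 = (u - 1) * ((u - 1) + ((2 : ℕ) : ℂ_[2])) := by push_cast; ring
  rw [hfac, norm_mul]
  exact mul_le_mul_of_nonneg_left (IsUltrametricDist.norm_add_le_max _ _) (norm_nonneg _)

/-- **Weight points contract geometrically**: `‖u^{2ⁿ} − 1‖ ≤ ‖u − 1‖ · rⁿ`, `r = max(‖u − 1‖, ‖2‖)`.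
(The character `χ'·⟨2ⁿ⟩` of weight `2ⁿ` sits at disc coordinate `u^{2ⁿ} − 1` on the `χ'`-disc.) -/
theorem norm_pow_two_pow_sub_one_le (u : ℂ_[2]) (hu : ‖u - 1‖ ≤ 1) (n : ℕ) :
    ‖u ^ (2 ^ n) - 1‖ ≤ ‖u - 1‖ * (max ‖u - 1‖ ‖((2 : ℕ) : ℂ_[2])‖) ^ n := by
  induction n with
  | zero => simp
  | succ n ih =>
    have hr0 : 0 ≤ max ‖u - 1‖ ‖((2 : ℕ) : ℂ_[2])‖ := le_max_of_le_left (norm_nonneg _)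
    have hr1 : max ‖u - 1‖ ‖((2 : ℕ) : ℂ_[2])‖ ≤ 1 := max_le hu norm_two_lt_one.le
    have hpow : u ^ (2 ^ (n + 1)) = (u ^ (2 ^ n)) ^ 2 := by rw [pow_succ, pow_mul]
    have hle1 : ‖u ^ (2 ^ n) - 1‖ ≤ ‖u - 1‖ :=
      calc ‖u ^ (2 ^ n) - 1‖ ≤ ‖u - 1‖ * (max ‖u - 1‖ ‖((2 : ℕ) : ℂ_[2])‖) ^ n := ih
        _ ≤ ‖u - 1‖ * 1 :=
          mul_le_mul_of_nonneg_left (pow_le_one₀ hr0 hr1) (norm_nonneg _)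
        _ = ‖u - 1‖ := mul_one _
    have hmax : max ‖u ^ (2 ^ n) - 1‖ ‖((2 : ℕ) : ℂ_[2])‖ ≤ max ‖u - 1‖ ‖((2 : ℕ) : ℂ_[2])‖ :=
      max_le_max hle1 le_rfl
    calc ‖u ^ (2 ^ (n + 1)) - 1‖ = ‖(u ^ (2 ^ n)) ^ 2 - 1‖ := by rw [hpow]
      _ ≤ ‖u ^ (2 ^ n) - 1‖ * max ‖u ^ (2 ^ n) - 1‖ ‖((2 : ℕ) : ℂ_[2])‖ := norm_sq_sub_one_le _
      _ ≤ (‖u - 1‖ * (max ‖u - 1‖ ‖((2 : ℕ) : ℂ_[2])‖) ^ n) * max ‖u - 1‖ ‖((2 : ℕ) : ℂ_[2])‖ :=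
          mul_le_mul ih hmax (le_max_of_le_left (norm_nonneg _))
            (mul_nonneg (norm_nonneg _) (pow_nonneg hr0 n))
      _ = ‖u - 1‖ * (max ‖u - 1‖ ‖((2 : ℕ) : ℂ_[2])‖) ^ (n + 1) := by rw [pow_succ]; ring

/-- **(H1) The weight-`2ⁿ` points converge to the weight-`0` point** on the `χ'`-disc: for `‖u − 1‖ < 1`,
`u^{2ⁿ} − 1 → 0` in `ℂ₂`.  No torsion of `Γ̃` and no parity coset enters: the approach is INSIDE one disc
of LZZ's character space `𝒟(ω, K)` (Remark 3.2.7: a finite union of open unit discs). -/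
theorem tendsto_pow_two_pow_sub_one (u : ℂ_[2]) (hu : ‖u - 1‖ < 1) :
    Tendsto (fun n : ℕ => u ^ (2 ^ n) - 1) atTop (𝓝 0) := by
  have hr0 : 0 ≤ max ‖u - 1‖ ‖((2 : ℕ) : ℂ_[2])‖ := le_max_of_le_left (norm_nonneg _)
  have hr1 : max ‖u - 1‖ ‖((2 : ℕ) : ℂ_[2])‖ < 1 := max_lt hu norm_two_lt_one
  have hgeom : Tendsto (fun n : ℕ => ‖u - 1‖ * (max ‖u - 1‖ ‖((2 : ℕ) : ℂ_[2])‖) ^ n)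
      atTop (𝓝 0) := by
    simpa using (tendsto_pow_atTop_nhds_zero_of_lt_one hr0 hr1).const_mul ‖u - 1‖
  exact squeeze_zero_norm (fun n => norm_pow_two_pow_sub_one_le u hu.le n) hgeom

/-- **(H2) Sequential continuity of an `𝒪_{ℂ_p}⟦T⟧`-branch at the disc centre**: values at `T_n → 0`
converge to the constant coefficient (LZZ: an element of `𝒟(ω,K)` restricted to one disc is such a
series after the kernel rescale, as at `p = 3` in `X2.exists_continuousDisplay_of_lzzRoadInputIoo`). -/
theorem tendsto_value_of_hasValueAt {p : ℕ} [Fact p.Prime] {Q : PowerSeries (PadicComplexInt p)}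
    {T v : ℕ → ℂ_[p]} (hv : ∀ n, IntSeries.HasValueAt Q (T n) (v n)) (hT1 : ∀ n, ‖T n‖ ≤ 1)
    (hT : Tendsto T atTop (𝓝 0)) :
    Tendsto v atTop (𝓝 ((PowerSeries.constantCoeff Q : PadicComplexInt p) : ℂ_[p])) := by
  rw [tendsto_iff_norm_sub_tendsto_zero]
  exact squeeze_zero (fun n => norm_nonneg _)
    (fun n => IntSeries.norm_sub_constantCoeff_le (hv n) (hT1 n))
    (tendsto_zero_iff_norm_tendsto_zero.mp hT)

/-- **(H3) Pointwise identities pass to the limit** (how (W-b)′ at the weight-0 point `χ'` follows from the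
in-range identities at the weight-`2ⁿ` points, and how LZZ themselves prove Thm 3.3.2). -/
theorem limit_law_of_pointwise {𝕜 : Type*} [NormedField 𝕜] {A B C D : ℕ → 𝕜} {a b c d : 𝕜}
    (h : ∀ n, A n * B n = C n * D n) (hA : Tendsto A atTop (𝓝 a)) (hB : Tendsto B atTop (𝓝 b))
    (hC : Tendsto C atTop (𝓝 c)) (hD : Tendsto D atTop (𝓝 d)) : a * b = c * d :=
  tendsto_nhds_unique (hA.mul hB) ((hC.mul hD).congr fun n => (h n).symm)

/-- **(H3⁻) One-sided version (what LOWER needs)**: a UNIFORM bound on the in-range constants passes to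
the limit without their convergence. -/
theorem norm_limit_le_of_pointwise {𝕜 : Type*} [NormedField 𝕜] {A B C : ℕ → 𝕜} {a b c : 𝕜}
    {K : ℝ} (h : ∀ n, ‖A n * B n‖ ≤ K * ‖C n‖) (hA : Tendsto A atTop (𝓝 a))
    (hB : Tendsto B atTop (𝓝 b)) (hC : Tendsto C atTop (𝓝 c)) : ‖a * b‖ ≤ K * ‖c‖ :=
  le_of_tendsto_of_tendsto' (hA.mul hB).norm (hC.norm.const_mul K) h

/-! ### §2. The valuation currency of the LZZ engine (ℤ-valued `ord₂` exponents) and the PROVED chains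

Names (all `ℤ`): `vG0` = ord₂ of S2′'s out-of-range value `G(0)` (T3's deliverable, `m = 2·vG0` in
k1-g6's doubled units); `vLin` = ord₂ of the in-range Katz value at the complementary point; `vL` =
ord₂ `𝓛(A_{f₀})(χ')`; `ℓp, ℓm` = ord₂ `log_{A^±} P^±_{χ'}(f_±)`; `ν n` = −ord₂ of LZZ's `𝔭`-factor
`L(1/2,ρ_{A,2}⊗χ̌')²/ε(1/2,ψ,ρ_{A,2}⊗χ̌')` at `2`-conductor exponent `n = n(key) ∈ {2,3}`; `aα` = ord₂ of
the local period `α_{χ'}(f₊,f₋)` (the SAME number in LZZ Thm 3.3.2 and in YZZ's Gross–Zagier formula);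
`a` = ord₂ `L^{alg}(ψ_W^c χ², 1)` (complementary central value); `w` = ord₂ of the factorisation constant
(W-b)′; `ρ n` = the in-range `𝔭`-digit of de Shalit (37); `kk, kb` = `ord_𝔓 κ`, `ord_𝔓 κ̄` of the Heegner
multiplier; `γ` = ord₂ of YZZ's archimedean Gross–Zagier constant in BSD-shape; `s, t, τ, i` = ord₂ of
`Ш_an(W)`, `Tam(W)`, `#W(ℚ)_tors`, and of the index of the ℚ-rational Heegner-class point in
`W(ℚ)/tors` (set `i = 0` if `κ` is measured against that point itself); `ℓ` = ord₂ `log_W P_gen`; `υ` =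
ord₂ of the `ω`-comparison units in the log projection (Néron differentials of `A^±` versus `ω_{W_d}`:
the twisting factor `√d·u_d`, a function of the LOCAL TYPE of `d` only).  Every "class constant" below is
a function on the finite set of local types `t = (class of d in ℚ₂^×/ℚ₂^{×2}, (d/7)-type, sign d)` — six
`2`-adic classes for `d ≢ 1 (4)` = the plan's six keys; ONE p-adic L-function `𝓛(A_{f₀}) ∈ 𝒟(A_{f₀}, ·)`
(all tame levels at once, LZZ Def 3.7) serves every member `W_d`, `d` entering only through the point `χ'
= χ₁·φ_d` at which it is evaluated. -/

/-- **E1 — LZZ value law** (Duke Thm 3.3.2 = arXiv Thm 3.10 at `(ℚ, K₀, 2, A_{f₀}, χ')`, EXACT):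
`log⁺·log⁻ = 𝓛(χ')·(L²/ε)_𝔭·α`, in valuations. [print, any `p`] -/
def LZZValueLaw (ℓp ℓm vL ν aα : ℤ) : Prop :=
  ℓp + ℓm = vL - ν + aα

/-- **E2 — factorisation at 2** of the CM form's anticyclotomic `𝓛(A_{f₀})` on the `χ'`-disc into the
out-of-range and the in-range Katz–de Shalit values: `G0·Lin = W₀·𝓛(χ')`, `ord₂ W₀ = w`.
[research-S/M at 2: LZZ Prop 4.3.4 ⊗ de Shalit (36)–(37) ⊗ `IntSeries.eq_of_infinite_hasValueAt_eq`] -/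
def FactorisationAtTwo (vG0 vLin w vL : ℤ) : Prop :=
  vG0 + vLin = w + vL

/-- **E2⁻** — the one-sided factorisation LOWER needs: `‖G0·Lin‖ ≤ 2^{−w}·‖𝓛(χ')‖`. -/
def FactorisationLowerAtTwo (vG0 vLin w vL : ℤ) : Prop :=
  w + vL ≤ vG0 + vLin

/-- **E3 — in range** (de Shalit II.4.14 (36)–(37) at the `𝔭`-ramified complementary point; carrier D2
`IsKatzBranchRamified` of R46): `ord₂ Lin = ρ(n) + a`. [print + D2] -/
def InRangeValuation (vLin ρ a : ℤ) : Prop :=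
  vLin = ρ + a

/-- **E4 — YZZ height law** (Yuan–Zhang–Zhang, Gross–Zagier on `X(𝔹)` in the pairing of E1, SAME
`f₊, f₋, χ'`, volume-one measures) combined with the GZK definition of `Ш_an(W)`:
`ord₂(κκ̄) = γ + s + t − 2τ + 2i + a + aα`. [print; `γ` a class constant] -/
def YZZHeightLaw (kk kb γ s t τ i a aα : ℤ) : Prop :=
  kk + kb = γ + s + t - 2 * τ + 2 * i + a + aα

/-- **E4⁻** — one-sided. -/
def YZZHeightLower (kk kb γ s t τ i a aα : ℤ) : Prop :=
  γ + s + t - 2 * τ + 2 * i + a + aα ≤ kk + kb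

/-- **E5 — log projection** (CM parametrisation algebra, `p`-free; k3-g3's Heegner-multiplier step in the
BILINEAR form: `log_{A⁺}P⁺ = κ·log_W P_gen·u₊`, `log_{A⁻}P⁻ = κ̄·log_W P_gen·u₋`, both read at `𝔓`):
`ℓp + ℓm = kk + kb + 2ℓ + υ`.  The c-balance `β = kk − kb` of k3-g3 (W-e) is NOT consumed. -/
def LogProjectionLaw (ℓp ℓm kk kb ℓ υ : ℤ) : Prop :=
  ℓp + ℓm = kk + kb + 2 * ℓ + υ

/-- **E5⁻** — one-sided. -/
def LogProjectionLower (ℓp ℓm kk kb ℓ υ : ℤ) : Prop :=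
  kk + kb + 2 * ℓ + υ ≤ ℓp + ℓm

/-- **THE EXACT CHAIN.**  E1–E5 give `vG0` in closed form; the complementary value `a` and the local
period `aα` CANCEL — neither occurs in the conclusion although both occur twice in the hypotheses. -/
theorem vG0_eq_of_chain {vG0 vLin vL w ℓp ℓm ν aα a ρ kk kb γ s t τ i ℓ υ : ℤ}
    (h1 : LZZValueLaw ℓp ℓm vL ν aα) (h2 : FactorisationAtTwo vG0 vLin w vL)
    (h3 : InRangeValuation vLin ρ a) (h4 : YZZHeightLaw kk kb γ s t τ i a aα)
    (h5 : LogProjectionLaw ℓp ℓm kk kb ℓ υ) :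
    vG0 = (w + γ + υ) + (ν - ρ) + s + t - 2 * τ + 2 * i + 2 * ℓ := by
  unfold LZZValueLaw FactorisationAtTwo InRangeValuation YZZHeightLaw LogProjectionLaw at *
  omega

/-- **THE ONE-SIDED CHAIN (LOWER).**  With E1 and E3 exact (print) and E2⁻, E4⁻, E5⁻ one-sided, the
lower bound on `vG0` that T3 feeds into `m ≥ …`; again free of `a` and `aα`. -/
theorem vG0_lower_of_chain {vG0 vLin vL w ℓp ℓm ν aα a ρ kk kb γ s t τ i ℓ υ : ℤ}
    (h1 : LZZValueLaw ℓp ℓm vL ν aα) (h2 : FactorisationLowerAtTwo vG0 vLin w vL)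
    (h3 : InRangeValuation vLin ρ a) (h4 : YZZHeightLower kk kb γ s t τ i a aα)
    (h5 : LogProjectionLower ℓp ℓm kk kb ℓ υ) :
    (w + γ + υ) + (ν - ρ) + s + t - 2 * τ + 2 * i + 2 * ℓ ≤ vG0 := by
  unfold LZZValueLaw FactorisationLowerAtTwo InRangeValuation YZZHeightLower LogProjectionLower at *
  omega

/-- **Cancellation made explicit**: whatever the (unknown, `d`-dependent) complementary value `a` and
local period `aα` are, the bound is the same — the engine needs NO non-vanishing-digit and NO
test-vector bookkeeping beyond existence. -/
theorem vG0_lower_of_exists {vG0 w ν ρ γ s t τ i ℓ υ : ℤ}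
    (h : ∃ a aα vLin vL ℓp ℓm kk kb : ℤ,
      LZZValueLaw ℓp ℓm vL ν aα ∧ FactorisationLowerAtTwo vG0 vLin w vL ∧
        InRangeValuation vLin ρ a ∧ YZZHeightLower kk kb γ s t τ i a aα ∧
        LogProjectionLower ℓp ℓm kk kb ℓ υ) :
    (w + γ + υ) + (ν - ρ) + s + t - 2 * τ + 2 * i + 2 * ℓ ≤ vG0 := by
  obtain ⟨a, aα, vLin, vL, ℓp, ℓm, kk, kb, h1, h2, h3, h4, h5⟩ := h
  exact vG0_lower_of_chain h1 h2 h3 h4 h5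

/-- **k1-g6 compatibility**: in the doubled units `m = 2·vG0` the chain reads
`m ≥ 2(s + t − 2τ + 2ℓ) + e_A⁻` with `e_A⁻ := 2(w + γ + υ) + 2(ν − ρ) + 4i`, i.e. k1-g6's shape
`m ≥ 2(q + t − 2τ + 2ℓ) + e_A⁻` with THEIR `4e − 2c − ρ + 2g + 2β` replaced by a CLASS constant plus a
`𝔭`-digit (and `β` absent). -/
theorem m_lower_doubled {vG0 m w ν ρ γ s t τ i ℓ υ eA : ℤ} (hm : m = 2 * vG0)
    (heA : eA = 2 * (w + γ + υ) + 2 * (ν - ρ) + 4 * i)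
    (h : (w + γ + υ) + (ν - ρ) + s + t - 2 * τ + 2 * i + 2 * ℓ ≤ vG0) :
    2 * (s + t - 2 * τ + 2 * ℓ) + eA ≤ m := by
  omega

/-! ### §3. The B8/B15 table: class constant + explicit digit; anchors CHECK, and their DIFFERENCE
eliminates the constant -/

/-- A per-key table row: `e(key) = C + dig t` — `C` the type-free constant (ONE number per good-pair menu
entry: `L(1,η_{K₀})², L(1,π_{A},Ad)`, Petersson and CM periods of the FIXED pair), `dig` the explicit row of
local digits indexed by the local type `t` of `d` (at 2: `ν(t) − ρ(t)` and the twisting digits in `υ, γ`;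
at 7 and ∞ likewise); `t` is coded by a natural number. -/
def TableRow (e C : ℤ) (dig : ℕ → ℤ) (n : ℕ) : Prop :=
  e = C + dig n

/-- **One anchor pins the class constant** (calibration — allowed only as a CROSS-CHECK of the closed-form
computation of `C`, B8: anchors check, never fit). -/
theorem anchor_pins_constant {e₁ C : ℤ} {dig : ℕ → ℤ} {n₁ : ℕ} (h : TableRow e₁ C dig n₁) :
    C = e₁ - dig n₁ := by
  unfold TableRow at h
  omega

/-- **The two in-tree anchors test the engine WITHOUT the constant**: `e₂ − e₁ = dig t₂ − dig t₁`.  For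
the class `49a^{(d)}` the anchors `N = 784` (`d = −1`, key (1,7), `n = 2`) and `N = 3136` (`d = −2`, key
(0,7), `n = 3`) share `sign d` and `(d/7)` and differ only in the `2`-adic class, so this is a non-vacuous
integer identity between BSD-known data (Miller, in tree) and the explicit `2`-adic digit rows — the
card's cheapest falsifier (F1); it needs NO period constant. -/
theorem anchor_difference {e₁ e₂ C : ℤ} {dig : ℕ → ℤ} {n₁ n₂ : ℕ} (h₁ : TableRow e₁ C dig n₁)
    (h₂ : TableRow e₂ C dig n₂) : e₂ - e₁ = dig n₂ - dig n₁ := by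
  unfold TableRow at h₁ h₂
  omega

/-- **Transport to every member**: once `C` is pinned (by computation, checked on an anchor), every key's
`e` is the explicit number `C + dig t`. -/
theorem member_value {e₁ e C : ℤ} {dig : ℕ → ℤ} {n₁ n : ℕ} (h₁ : TableRow e₁ C dig n₁)
    (h : TableRow e C dig n) : e = e₁ - dig n₁ + dig n := by
  unfold TableRow at h₁ h
  omega

end Summit.BirchSwinnertonDyer.BirchSwinnertonDyer.Cruxes.SplitBadTwoLowerHalfOfFacts.HeegnerIndexTwo.K2G6

end
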